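import Summits.QuantumFields.YangMills.Theorems.BalabanUVNodesN15KingModelSchwingerFunctionsPositivity
import Summits.QuantumFields.YangMills.Theorems.BalabanUVNodesN15KingModelSchwingerFunctionsRate
import Summits.QuantumFields.YangMills.Theorems.BalabanUVNodesN15KingModelBlockCovarianceContinuumLimit

/-!
# BalabanUVNodes ∕ N15 — THE KING-MODEL RUNG (PART Ϻ-k): GRIFFITHS' FIRST INEQUALITY FOR KING's FINITE-`η` OBJECTS —
# `−η⁻²Δ + m²` on the fine torus is a dominant Z-matrix ⇒ `C^η = (−η⁻²Δ+m²)⁻¹ ≥ 0` entrywise ⇒ `S₂^{(K)} ≥ 0`, `(Δ^{(K)})⁻¹ ≥ 0` entrywise ⇒ EVERY `n`-point function of the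
# block averages of the fine free field and of King's RG block-field laws `dμ^{(K)}` is `≥ 0`, at every lattice spacing `η = L^{−K}`, every volume
# (Track A, DAG node N15 = NE2; FAN-OUT v1.1 §N15 s3 «KING-MODEL RUNG»; uses parts Ͱ-c∕f, Ϛ, Ϡ-e, Ϻ-e and the finite maximum principle for dominant Z-matrices; count-neutral)

HONEST FRAMING.  Count-neutral (cell `pub-ymgap`, seat `pub-ymgap-dag-n15-e` g35; `--supports stmt-QuantumFields-27366 --as helper` = K3⁸).  King's `A = 0`, `g = 0` model
([King1986] C. King, Commun. Math. Phys. **102** (1986) 649–677).  Parts Ϻ-b∕e proved positivity for the CONTINUUM (`K = ∞`, `|Ω| = ∞`) block field.  THIS FILE treats KING's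
ACTUAL FINITE-`η` OBJECTS on the finite tori: the fine-lattice operator `B = N²(−Δ) + m²` (`lapF (fine N M) N² m²`, `N = L^K = η⁻¹`, (4.4)) has non-positive off-diagonal
entries and row sums exactly `m² > 0` — a DOMINANT Z-MATRIX; the finite maximum principle (look at a minimum of `u` when `Bu ≥ 0`) gives `B⁻¹ ≥ 0` ENTRYWISE.
(The tree has this principle as `Balaban1983to89.B9SectCDiffCutModelToy5.IsDomZ.inv_nonneg`, in a module outside the built cone of this chain; the twenty-line argument is
re-proved here PRIVATELY for King's operator rather than imported.)  Since the block mean `Q` has non-negative entries, King's block two-point function `S₂^{(K)} = N^{d+1}(QB⁻¹Qᵀ)` ((2.13)–(2.14), part Ϝ-d's `kingS2`) is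
entrywise `≥ 0`, and so is NE2's unit kernel `(Δ^{(K)})⁻¹ = a_K⁻¹·1 + S₂^{(K)}` (part Ϛ ∕ Ͱ-f's identity); by part Ͱ-c's hafnian formulas and part Ϻ-e's `hafnian_nonneg_of_nonneg`,
EVERY `n`-point Schwinger function of the block averages of the fine free field (law `ρ_{P_K}`) and of King's RG block-field measures `dμ^{(K)} ∝ e^{−½⟨ψ,Δ^{(K)}ψ⟩}dψ` is
`≥ 0` — GRIFFITHS' FIRST INEQUALITY at every `K ≥ 1`, every volume, every configuration of (possibly repeated) block sites; and the `K → ∞` limits `S₂^{(∞)}`, `C^{(∞)}`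
inherit `≥ 0`.  (STRICT positivity of the finite-`η` kernels needs the irreducibility of the torus Laplacian and is not typed here; parts Ϻ-b∕e have it at `K = |Ω| = ∞`.)
NOT Bałaban's objects; NOT a node discharge; nothing continuum-Yang–Mills ∕ `ℝ⁴` ∕ OS ∕ Clay.  0 `sorry`, 0 def; standard axioms.

WHAT THIS FILE PROVES (kernel).  §1 `lapF_offdiag_nonpos`, `sum_lapF_row` (`= m²`), private maximum principle, `lapF_mulVec_injective`, `isUnit_lapF` (every torus), ★★ **`lapF_inv_nonneg`**, `Qmat_nonneg`.  §2 ★★★ **`kingS2_nonneg`** (every `N`, volume),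
★★ **`blockCov_nonneg`** (`K ≥ 1`), ★ `kingS2Lim_nonneg`, ★ `blockCovLim_nonneg`.  §3 ★★★ **`nPoint_fineBlockLaw_nonneg`**, ★★★ **`nPoint_blockFieldLaw_nonneg`**, ★★ `nPoint_fineBlockLawLim_nonneg`,
★★ `nPoint_blockFieldLawLim_nonneg`.

HONEST SCOPE.  King's free model, `A = 0`; entrywise NON-negativity (not strict) at finite `η`.  N15 untouched; counts unmoved.  Locators (use): [King1986] (2.4)–(2.6) p.652,
(2.13)–(2.14) p.653, Thm 2.1 (2.22)–(2.23) p.654, (4.4)–(4.5) p.670.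
-/

noncomputable section

open scoped BigOperators Topology
open Filter MeasureTheory Finset Matrix

namespace Summit.QuantumFields.YangMills.BalabanUVNodes.N15KingModelRung.ProperTime

open Literature.MathematicalPhysics.QuantumFieldTheory.Balaban1983to89.B5Prop11Plancherel (Tor fine)
open Literature.MathematicalPhysics.QuantumFieldTheory.King1986.Torus
open Literature.MathematicalPhysics.QuantumFieldTheory.King1986 (aK aK_pos)
open Literature.Combinatorics.Enumerative (hafnian)
open Literature.Combinatorics.Enumerative.HafnianGeneratingFunction (subMat)
open FreeField

variable {d : ℕ}

/-! ## §1 King's fine-lattice operator `c(−Δ) + m²` is a dominant Z-matrix -/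

section Fine

variable {n : ℕ} (K : Fin n → ℕ) [hK : ∀ μ, NeZero (K μ)]

omit hK in
/-- Off-diagonal entries of `c(−Δ) + m²` are `≤ 0` (`c ≥ 0`; on small tori the wrap-around only adds more `−c`'s). [cite: King1986, (4.4) p.670] -/
theorem lapF_offdiag_nonpos {c : ℝ} (hc : 0 ≤ c) (m2 : ℝ) {z z' : Tor K} (h : z ≠ z') : lapF K c m2 z z' ≤ 0 := by
  unfold lapF
  rw [if_neg (Ne.symm h), mul_zero, zero_sub, neg_nonpos]
  exact mul_nonneg hc (Finset.sum_nonneg fun μ _ => add_nonneg (by split_ifs <;> norm_num) (by split_ifs <;> norm_num))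

/-- Every row of `c(−Δ) + m²` sums to `m²` (the Laplacian kills constants). [cite: King1986, (4.4) p.670] -/
theorem sum_lapF_row (c m2 : ℝ) (z : Tor K) : ∑ z', lapF K c m2 z z' = m2 := by
  unfold lapF
  rw [Finset.sum_sub_distrib, ← Finset.mul_sum, ← Finset.mul_sum, Finset.sum_comm]
  simp only [Finset.sum_add_distrib, Finset.sum_ite_eq', Finset.mem_univ, if_true, Finset.sum_const, Finset.card_univ, Fintype.card_fin,
    nsmul_eq_mul]
  ring

/-- The finite MAXIMUM PRINCIPLE for `c(−Δ) + m²`: `(c(−Δ)+m²)u ≥ 0` entrywise forces `u ≥ 0` (look at a minimum of `u`; `c ≥ 0`, `m² > 0`). [folklore] -/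
private theorem nonneg_of_lapF_mulVec_nonneg {c m2 : ℝ} (hc : 0 ≤ c) (hm : 0 < m2) {u : Tor K → ℝ} (hu : ∀ z, 0 ≤ (lapF K c m2).mulVec u z) (z : Tor K) :
    0 ≤ u z := by
  obtain ⟨z₀, -, hmin⟩ := Finset.exists_min_image Finset.univ u ⟨z, Finset.mem_univ z⟩
  have hmin' : ∀ w, u z₀ ≤ u w := fun w => hmin w (Finset.mem_univ w)
  by_contra hneg
  have h0 : u z₀ < 0 := lt_of_le_of_lt (hmin' z) (lt_of_not_ge hneg)
  have key : (lapF K c m2).mulVec u z₀ ≤ (∑ w, lapF K c m2 z₀ w) * u z₀ := by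
    simp only [Matrix.mulVec, dotProduct, Finset.sum_mul]
    refine Finset.sum_le_sum fun w _ => ?_
    by_cases hw : z₀ = w
    · rw [hw]
    · exact mul_le_mul_of_nonpos_left (hmin' w) (lapF_offdiag_nonpos K hc m2 hw)
  rw [sum_lapF_row K c m2 z₀] at key
  have h1 : m2 * u z₀ < 0 := mul_neg_of_pos_of_neg hm h0
  linarith [hu z₀]

/-- `c(−Δ) + m²` acts injectively (`c ≥ 0`, `m² > 0`). [folklore] -/
theorem lapF_mulVec_injective {c m2 : ℝ} (hc : 0 ≤ c) (hm : 0 < m2) : Function.Injective (lapF K c m2).mulVec := by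
  intro u v huv
  funext z
  have h1 := nonneg_of_lapF_mulVec_nonneg K hc hm (u := u - v) (fun w => by simp [Matrix.mulVec_sub, huv]) z
  have h2 := nonneg_of_lapF_mulVec_nonneg K hc hm (u := v - u) (fun w => by simp [Matrix.mulVec_sub, huv]) z
  simp only [Pi.sub_apply, sub_nonneg] at h1 h2
  exact le_antisymm h2 h1

/-- `c(−Δ) + m²` is invertible on EVERY torus (`c ≥ 0`, `m² > 0`; the tree's `King1986.Torus.lapF_isUnit` is the fine-torus case). [cite: King1986, (4.4) p.670] -/
theorem isUnit_lapF {c m2 : ℝ} (hc : 0 ≤ c) (hm : 0 < m2) : IsUnit (lapF K c m2) :=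
  Matrix.mulVec_injective_iff_isUnit.mp (lapF_mulVec_injective K hc hm)

/-- ★★ **INVERSE POSITIVITY OF THE FINE PROPAGATOR**: `((c(−Δ) + m²)⁻¹)(z,z′) ≥ 0` for all sites of every torus (`c ≥ 0`, `m² > 0`): `c(−Δ)+m²` is a dominant Z-matrix
(off-diagonal `≤ 0`, row sums `m² > 0`) and the maximum principle applies to the columns of its inverse. [cite: King1986, (4.4) p.670, (2.13) p.653] -/
theorem lapF_inv_nonneg {c m2 : ℝ} (hc : 0 ≤ c) (hm : 0 < m2) (z z' : Tor K) : 0 ≤ (lapF K c m2)⁻¹ z z' := by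
  have hdet : IsUnit (lapF K c m2).det := (Matrix.isUnit_iff_isUnit_det _).mp (isUnit_lapF K hc hm)
  refine nonneg_of_lapF_mulVec_nonneg K hc hm (u := fun w => (lapF K c m2)⁻¹ w z') (fun w => ?_) z
  have hcol : (lapF K c m2).mulVec (fun w => (lapF K c m2)⁻¹ w z') w = ((lapF K c m2) * (lapF K c m2)⁻¹) w z' := by
    simp only [Matrix.mulVec, dotProduct, Matrix.mul_apply]
  rw [hcol, Matrix.mul_nonsing_inv _ hdet, Matrix.one_apply]
  split_ifs <;> norm_num

end Fine

/-- King's block mean has non-negative entries. [cite: King1986, (2.4) p.652] -/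
theorem Qmat_nonneg (N : ℕ) [NeZero N] (M : Fin (d + 1) → ℕ) [∀ ν, NeZero (M ν)] (b : Tor M) (z : Tor (fine N M)) : 0 ≤ Qmat N M b z := by
  unfold Qmat
  split_ifs
  · positivity
  · exact le_rfl

/-! ## §2 `S₂^{(K)} ≥ 0` and `(Δ^{(K)})⁻¹ ≥ 0` entrywise -/

section Kernels

variable (L : ℕ) (M : Fin (d + 1) → ℕ) [hM : ∀ ν, NeZero (M ν)]

omit hM in
/-- ★★★ **KING's BLOCK TWO-POINT FUNCTION IS ENTRYWISE NON-NEGATIVE**: `S₂^{(K)}(b,b′) = N^{d+1}(QB⁻¹Qᵀ)(b,b′) ≥ 0` for every fine level `N`, every volume, all `b, b′` (`m² > 0`).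
[cite: King1986, (2.13)–(2.14) p.653, Thm 2.1 (2.23) p.654] -/
theorem kingS2_nonneg [∀ ν, NeZero (M ν)] (N : ℕ) [NeZero N] {m2 : ℝ} (hm : 0 < m2) (b b' : Tor M) : 0 ≤ kingS2 N M m2 b b' := by
  unfold kingS2
  refine mul_nonneg (by positivity) ?_
  rw [Matrix.mul_apply]
  refine Finset.sum_nonneg fun z' _ => mul_nonneg ?_ (by rw [Matrix.transpose_apply]; exact Qmat_nonneg N M b' z')
  rw [Matrix.mul_apply]
  exact Finset.sum_nonneg fun z _ => mul_nonneg (Qmat_nonneg N M b z) (lapF_inv_nonneg (fine N M) (by positivity) hm z z')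

/-- ★★ **NE2's UNIT KERNEL IS ENTRYWISE NON-NEGATIVE**: `(Δ^{(K)})⁻¹(b,b′) = a_K⁻¹[b=b′] + S₂^{(K)}(b,b′) ≥ 0` (`L ≥ 2`, `a, m² > 0`, `K ≥ 1`).
[cite: King1986, (2.14) p.653, (4.5) p.670] -/
theorem blockCov_nonneg (hL : 2 ≤ L) {a m2 : ℝ} (ha : 0 < a) (hm : 0 < m2) {K : ℕ} (hK : 1 ≤ K) (b b' : Tor M) :
    haveI : NeZero L := ⟨by omega⟩
    0 ≤ blockCov L (L ^ K) M a m2 K b b' := by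
  haveI : NeZero L := ⟨by omega⟩
  have hL1 : (1 : ℝ) < L := by exact_mod_cast (show 1 < L by omega)
  rw [blockCov_eq_kingS2_add_noise L M hL ha hm hK]
  refine add_nonneg (kingS2_nonneg M (L ^ K) hm b b') (mul_nonneg (inv_nonneg.mpr (aK_pos ha hL1 hK).le) ?_)
  split_ifs <;> norm_num

/-- ★ The `K → ∞` block two-point function `S₂^{(∞)}` is entrywise `≥ 0` (`L` odd, `L ≥ 2`). [cite: King1986, Thm 2.1 (2.22) p.654] -/
theorem kingS2Lim_nonneg (hLodd : Odd L) (hL : 2 ≤ L) {m2 : ℝ} (hm : 0 < m2) (b b' : Tor M) : 0 ≤ kingS2Lim M m2 b b' := by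
  haveI : NeZero L := ⟨by omega⟩
  exact ge_of_tendsto' (tendsto_kingS2 L M hLodd hL hm b b') fun K => kingS2_nonneg M (L ^ K) hm b b'

/-- ★ The `K → ∞` unit kernel `C^{(∞)}` is entrywise `≥ 0` (`L` odd, `L ≥ 2`, `a, m² > 0`). [cite: King1986, (2.14) p.653, (4.5) p.670] -/
theorem blockCovLim_nonneg (hLodd : Odd L) (hL : 2 ≤ L) {a m2 : ℝ} (ha : 0 < a) (hm : 0 < m2) (b b' : Tor M) : 0 ≤ blockCovLim L M a m2 b b' := by
  haveI : NeZero L := ⟨by omega⟩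
  refine ge_of_tendsto (tendsto_blockCov L M hLodd hL ha hm b b') ?_
  filter_upwards [eventually_ge_atTop 1] with K hK using blockCov_nonneg L M hL ha hm hK b b'

end Kernels

/-! ## §3 Griffiths' first inequality for King's finite-`η` laws -/

section NPoint

variable (L : ℕ) (M : Fin (d + 1) → ℕ) [hM : ∀ ν, NeZero (M ν)]
variable {W : Type*} [DecidableEq W] [LinearOrder W]

/-- ★★★ **GRIFFITHS I, FINE BLOCK AVERAGES**: for every fine level `N` (`η = 1∕N`), every volume, `m² > 0`, block sites `p : W → 𝕋_M` and finite `S`: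
`0 ≤ ∫∏_{i∈S}φ(p_i)ρ_{P_N}(φ)dφ` — every `n`-point function of the block averages of the fine free field is non-negative. [cite: King1986, (2.6) p.652, (2.13) p.653, Thm 2.1 (2.23) p.654] -/
theorem nPoint_fineBlockLaw_nonneg (N : ℕ) [NeZero N] {m2 : ℝ} (hm : 0 < m2) (p : W → Tor M) (S : Finset W) :
    0 ≤ ∫ φ : Tor M → ℝ, (∏ i ∈ S, φ (p i)) * gaussDensity (fineBlockPrec M N m2) φ := by
  rw [integral_prod_eval_fineBlockLaw_eq_hafnian M N hm p S]
  exact hafnian_nonneg_of_nonneg fun u v => kingS2_nonneg M N hm _ _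

/-- ★★★ **GRIFFITHS I, KING's RG BLOCK-FIELD MEASURES**: for `L ≥ 2`, `a, m² > 0`, `K ≥ 1`, every volume, block sites `p` and finite `S`:
`0 ≤ ∫∏_{i∈S}ψ(p_i)dμ^{(K)}(ψ)`, `dμ^{(K)} ∝ e^{−½⟨ψ,Δ^{(K)}ψ⟩}dψ` — every `n`-point function of the `K`-fold renormalised free block field is non-negative.
[cite: King1986, (2.10)–(2.14) pp.652–653, (4.5) p.670] -/
theorem nPoint_blockFieldLaw_nonneg (hL : 2 ≤ L) {a m2 : ℝ} (ha : 0 < a) (hm : 0 < m2) {K : ℕ} (hK : 1 ≤ K) (p : W → Tor M) (S : Finset W) :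
    haveI : NeZero L := ⟨by omega⟩
    0 ≤ ∫ ψ : Tor M → ℝ, (∏ i ∈ S, ψ (p i)) * gaussDensity (effLaplacian (L ^ K) M (aK a L K) (((L ^ K : ℕ) : ℝ) ^ 2) m2) ψ := by
  haveI : NeZero L := ⟨by omega⟩
  rw [integral_prod_eval_blockFieldLaw_eq_hafnian L M hL ha hm hK p S]
  exact hafnian_nonneg_of_nonneg fun u v => blockCov_nonneg L M hL ha hm hK _ _

/-- ★★ Griffiths I for the `K = ∞` fine block-average law. [cite: King1986, Thm 2.1 (2.22)–(2.23) p.654] -/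
theorem nPoint_fineBlockLawLim_nonneg (hLodd : Odd L) (hL : 2 ≤ L) {m2 : ℝ} (hm : 0 < m2) (p : W → Tor M) (S : Finset W) :
    0 ≤ ∫ φ : Tor M → ℝ, (∏ i ∈ S, φ (p i)) * gaussDensity (fineBlockPrecLim M m2) φ := by
  rw [integral_prod_eval_fineBlockLawLim_eq_hafnian L M hLodd hL hm p S]
  exact hafnian_nonneg_of_nonneg fun u v => kingS2Lim_nonneg L M hLodd hL hm _ _

/-- ★★ Griffiths I for the `K = ∞` RG block-field law `dμ^{(∞)}`. [cite: King1986, (2.14) p.653, (4.5) p.670] -/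
theorem nPoint_blockFieldLawLim_nonneg (hLodd : Odd L) (hL : 2 ≤ L) {a m2 : ℝ} (ha : 0 < a) (hm : 0 < m2) (p : W → Tor M) (S : Finset W) :
    0 ≤ ∫ ψ : Tor M → ℝ, (∏ i ∈ S, ψ (p i)) * gaussDensity (Matrix.of fun b b' => effLaplacianLim L M a m2 b b') ψ := by
  rw [integral_prod_eval_blockFieldLawLim_eq_hafnian L M hLodd hL ha hm p S]
  exact hafnian_nonneg_of_nonneg fun u v => blockCovLim_nonneg L M hLodd hL ha hm _ _

end NPoint

end Summit.QuantumFields.YangMills.BalabanUVNodes.N15KingModelRung.ProperTime
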